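import Mathlib
import Summits.QuantumFields.YangMills.Theorems.CoarseStiffnessTailCappedCoarseStiffnessLDeepTailReduction
import Summits.QuantumFields.YangMills.Theorems.CoarseStiffnessTailCappedCoarseStiffnessLMeanAction

/-!
# Route `CoarseStiffnessTail` — THE CRUX FACTORISES EXACTLY INTO THREE TAILS: EDGE-deep ∧ BULK-deep ∧ UNIFORM MEAN ACTION
# (lead's certificate, seat `ym-line-cst-p1` g14; helper on 25301 `CappedCoarseStiffnessL`; skeleton v7's composition)

THE THEOREMS (the crux's objects verbatim; UMA = g12's uniform mean action
`∀ L ∃ C γ₁ ∀ F (F.L = L) ∀ γ ∈ (0, γ₁] ∀ K: β_K·∫Σ_a|U(∂a) − 1|² dGibbs_K ≤ C·#Plaq_0`, UBS = its exponential form, `ubs_of_uma`).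
* ★ `coarseStiffness_boundedDepth_of_ubs`: UBS ⇒ for every `L`, `j₀`: the UNCAPPED stiffness of the `j`-fold averaged field, `j ≤ min(j₀, K)`, has
  free energy `O_{L,j₀}(1)` per level-`j` plaquette UNIFORMLY in `γ ≤ γ₁`, `K`, `m` (the quadratic transfer `…LQuadraticTransfer` /
  `…LBoundedDepthCompactCoupling.sum_avg_sq_le` moves the tilt to the bare level with coefficient `D_j²3(2j+1)³/L^j`).
* ★★ `subThresholdStiffness_of_deep_and_ubs`: v5's BULK stub ⇐ its DEEP tail (`j > j₀`, SOME `j₀`) ∧ UBS.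
* ★★★ `cappedCoarseStiffnessL_of_threeStubs`: EDGE-deep ∧ BULK-deep ∧ UMA ⇒ `CappedCoarseStiffnessL` (stmt-QuantumFields-25301) — the composition of
  the reshaped skeleton v7 — and ★★★ `threeStubs_of_cappedCoarseStiffnessL` / `cappedCoarseStiffnessL_iff_threeStubs`: the factorisation is EXACT
  (g8's `…_of_cappedCoarseStiffnessL` restricted, g12's `uma_of_cappedCoarseStiffnessL`).

WHAT IT SAYS (line card `Cruxes/CappedCoarseStiffnessL/Lines/birth.md` §g14).  The crux is EQUIVALENT to the conjunction of three statements
with disjoint content: (S1) EDGE-deep — ONE joint-Peierls rate for the large AVERAGED plaquettes at ALL deep heights ([Balaban1985UV3] (71)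
integrated; every bounded height is g13's theorem); (S2) BULK-deep — Gaussian small-field control of the averaged plaquettes at ALL deep heights
((5)/(70)); (S3) UMA — the uniform mean action of the Wilson law on ALL of Bałaban's three-tori, `β_K⟨A⟩ = O(#Plaq_0)` uniformly in `γ ≤ γ₁`,
`K`, `m`: a classical statement WITHOUT renormalisation-group content, PROVED on every compact coupling range by
`…LBareCompactCoupling.uma_compactCoupling` (this seat, from the N13 partition sandwich), whose only residual is the superweak corner
`log γ⁻¹ ≳ 2L^{m+K}` of a fixed lattice (uniform Laplace exponent; g2/g12).  (S1), (S2) are the located multi-scale content; (S3) is what the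
crux's typing `∃ C₀ ∀ γ ≤ γ₁` adds to it, and disappears under the planner re-type `∀ γ ∃ C₀`.

HONEST SCOPE.  Bookkeeping over landed certificates; nothing of Bałaban's estimates is asserted; the crux 25301, the three stubs, `HistoryTailL`
19936 and every rung above stay OPEN; `YM3TorusSU2` (R3, RECORD rung, not Clay) is NOT proved; the Yang–Mills mass gap is NOT touched.

References: T. Bałaban, CMP **102** (1985) 255–275 [Balaban1985UV3] ((5) p.256, (7) p.257, (70)–(71) p.273); CMP **98** (1985) 17–51
[Balaban1985Averaging] (Prop. 1 (51) p.26).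
-/

noncomputable section

namespace Summit.QuantumFields.YangMills.Theorems.CoarseStiffnessTailThreeTails

open MeasureTheory Finset
open Literature.MathematicalPhysics.QuantumFieldTheory
open Literature.MathematicalPhysics.QuantumFieldTheory.Balaban1983to89
open Literature.MathematicalPhysics.QuantumFieldTheory.Balaban1983to89.BlockAveraging (blockAvg)
open Literature.MathematicalPhysics.QuantumFieldTheory.Balaban1983to89.ExpMeanLog (deltaSU)
open Literature.MathematicalPhysics.QuantumFieldTheory.Balaban1983to89.T3ContinuumYM3Torus
open Literature.MathematicalPhysics.QuantumFieldTheory.Balaban1983to89.T3UnitScaleTilt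
open Literature.MathematicalPhysics.QuantumFieldTheory.Balaban1983to89.T3UnitLawDensityEML
open Summit.QuantumFields.YangMills.Theorems.CoarseStiffnessTailPressureConvexity (sqSum_mem measurable_sqSum integrable_of_bounded ubs_of_uma)
open Summit.QuantumFields.YangMills.Theorems.CoarseStiffnessTailEdgeBoundedDepth (beta_eq_pow_mul)
open Summit.QuantumFields.YangMills.Theorems.CoarseStiffnessTailBareUniformCount (uniformLargeFieldCount_of_pos)
open Summit.QuantumFields.YangMills.Theorems.CoarseStiffnessTailEdgeBulkFactorisation
  (cappedCoarseStiffnessL_of_subThreshold_and_uniformCount uniformLargeFieldCount_of_cappedCoarseStiffnessL subThresholdStiffness_of_cappedCoarseStiffnessL)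
open Summit.QuantumFields.YangMills.Theorems.CoarseStiffnessTailMeanAction (uma_of_cappedCoarseStiffnessL)
open Summit.QuantumFields.YangMills.Theorems.CoarseStiffnessTailBoundedDepthCompactCoupling (sum_avg_sq_le card_plaq_zero_eq_pow_mul integral_exp_avg_dominated_le)
open Summit.QuantumFields.YangMills.Theorems.CoarseStiffnessTailDeepTailReduction (integral_exp_bulk_mono uniformLargeFieldCountPos_of_deep)

/-! ## §1 UBS ⇒ the uncapped stiffness of the averaged field at bounded depth, uniformly in `γ ≤ γ₁` -/

section OfUBS

/-- **★ UNCAPPED BARE STIFFNESS ⇒ UNCAPPED COARSE STIFFNESS AT BOUNDED DEPTH** (uniformly in `γ ≤ γ₁`, `K`, `m`; every tilt `0 ≤ c ≤ c₀`):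
the quadratic transfer moves the level-`j` tilt to the bare level with coefficient `D_j²·3(2j+1)³/L^j`. [cite: Balaban1985Averaging, Prop. 1 (51) p.26] -/
theorem coarseStiffness_boundedDepth_of_ubs
    (hU : ∀ (L : ℕ), ∃ (c₀ C₀ γ₁ : ℝ), 0 < c₀ ∧ 0 < γ₁ ∧ γ₁ ≤ 1 ∧ ∀ (F : T3Family) (γ : ℝ), F.L = L → 0 < γ → γ ≤ γ₁ → ∀ (K : ℕ),
      ∫ U, Real.exp (c₀ * (γ * ((F.L : ℝ)⁻¹) ^ K)⁻¹ * ∑ a : Plaq (F.P K) 0, dist1 (GaugeField.plaqHol U a) ^ 2)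
          ∂(gibbsK F ℰp γ K) ≤ Real.exp (C₀ * (Fintype.card (Plaq (F.P K) 0) : ℝ)))
    (L j₀ : ℕ) :
    ∃ (c₀ C₀ γ₁ : ℝ), 0 < c₀ ∧ 0 < γ₁ ∧ γ₁ ≤ 1 ∧ ∀ (F : T3Family), F.L = L → ∀ (γ : ℝ), 0 < γ → γ ≤ γ₁ → ∀ (K j : ℕ), j ≤ j₀ → j ≤ K →
      ∀ (c : ℝ), 0 ≤ c → c ≤ c₀ →
      ∫ U, Real.exp (c * (γ * ((F.L : ℝ)⁻¹) ^ (K - j))⁻¹ * ∑ a : Plaq (F.P K) j, GaugeGroup.dist1 (GaugeField.plaqHol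
          (Averaging.iter (fun i => blockAvg (P := F.P K) (j := i) ℰp) j U) a) ^ 2) ∂(gibbsK F ℰp γ K) ≤
        Real.exp (C₀ * (Fintype.card (Plaq (F.P K) j) : ℝ)) := by
  obtain ⟨cu, Cu, γu, hcu, hγu, hγu1, hUb⟩ := hU L
  -- the transfer constants, written with `L`
  set C₁ : ℝ := (L : ℝ) ^ 2 + 6 * (((3 + 2) * L : ℕ) : ℝ) ^ 2 with hC₁
  set g : ℕ → ℝ := fun j => ((max (C₁ ^ j) (4 * ((((3 + 2) * L : ℕ) : ℝ) ^ 2 / 4) * C₁ ^ (j - 1) / deltaSU (Fin 2))) ^ 2 *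
    ((3 * (2 * j + 1) ^ 3 : ℕ) : ℝ) + 1)⁻¹ with hg
  have hg0 : ∀ j, 0 < g j := fun j => by rw [hg]; positivity
  have hne : (range (j₀ + 1)).Nonempty := ⟨0, by simp⟩
  set κ : ℝ := (range (j₀ + 1)).inf' hne g with hκ
  have hκ0 : 0 < κ := by rw [hκ]; exact (Finset.lt_inf'_iff hne).2 fun j _ => hg0 j
  refine ⟨cu * κ, max Cu 0 * (L : ℝ) ^ (3 * j₀), γu, mul_pos hcu hκ0, hγu, hγu1, fun F hFL γ hγ hγle K j hj hjK c hc hcle => ?_⟩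
  have hκj : κ ≤ g j := by rw [hκ]; exact Finset.inf'_le g (mem_range.2 (by omega))
  have hfine := hUb F γ hFL hγ hγle K
  subst hFL
  set βK : ℝ := (γ * ((F.L : ℝ)⁻¹) ^ K)⁻¹ with hβK
  set βKj : ℝ := (γ * ((F.L : ℝ)⁻¹) ^ (K - j))⁻¹ with hβKj
  set D : ℝ := max (C₁ ^ j) (4 * ((((3 + 2) * F.L : ℕ) : ℝ) ^ 2 / 4) * C₁ ^ (j - 1) / deltaSU (Fin 2)) with hD
  set M : ℝ := ((3 * (2 * j + 1) ^ 3 : ℕ) : ℝ) with hM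
  have hL1 : (1 : ℝ) ≤ F.L := by exact_mod_cast F.hL.2.le
  have hLj : (1 : ℝ) ≤ (F.L : ℝ) ^ j := one_le_pow₀ hL1
  have hβKj0 : 0 ≤ βKj := inv_nonneg.2 (mul_nonneg hγ.le (pow_nonneg (inv_nonneg.2 (Nat.cast_nonneg _)) _))
  have hscale : βK = (F.L : ℝ) ^ j * βKj := beta_eq_pow_mul F hjK
  have hβK0 : 0 ≤ βK := by rw [hscale]; positivity
  haveI := isProbabilityMeasure_gibbsK F ℰp hγ.le K
  have hgj : g j = (D ^ 2 * M + 1)⁻¹ := by rw [hg]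
  -- the fine coefficient is at most `cu`
  have hcoef : c * (D ^ 2 * M) ≤ cu * (F.L : ℝ) ^ j := by
    have h1 : c * (D ^ 2 * M) ≤ cu * κ * (D ^ 2 * M) := mul_le_mul_of_nonneg_right hcle (by positivity)
    have h2 : κ * (D ^ 2 * M) ≤ 1 := by
      calc κ * (D ^ 2 * M) ≤ (D ^ 2 * M + 1)⁻¹ * (D ^ 2 * M) := mul_le_mul_of_nonneg_right (hgj ▸ hκj) (by positivity)
        _ ≤ (D ^ 2 * M + 1)⁻¹ * (D ^ 2 * M + 1) := mul_le_mul_of_nonneg_left (by linarith) (by positivity)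
        _ = 1 := inv_mul_cancel₀ (by positivity)
    calc c * (D ^ 2 * M) ≤ cu * κ * (D ^ 2 * M) := h1
      _ = cu * (κ * (D ^ 2 * M)) := by ring
      _ ≤ cu * 1 := mul_le_mul_of_nonneg_left h2 hcu.le
      _ ≤ cu * (F.L : ℝ) ^ j := by rw [mul_one]; exact le_mul_of_one_le_right hcu.le hLj
  -- pointwise domination of the exponents
  have hpt : ∀ U : GaugeField (F.P K) 0 (Matrix.specialUnitaryGroup (Fin 2) ℂ),
      c * βKj * ∑ a : Plaq (F.P K) j, GaugeGroup.dist1 (GaugeField.plaqHol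
          (Averaging.iter (fun i => blockAvg (P := F.P K) (j := i) ℰp) j U) a) ^ 2 ≤
        cu * βK * ∑ q : Plaq (F.P K) 0, GaugeGroup.dist1 (GaugeField.plaqHol U q) ^ 2 := fun U => by
    have ht := sum_avg_sq_le F K j hjK U
    have hd : (F.P K).d = 3 := rfl
    have hL : (F.P K).L = F.L := rfl
    simp only [hd, hL] at ht
    have hS0 : 0 ≤ ∑ q : Plaq (F.P K) 0, GaugeGroup.dist1 (GaugeField.plaqHol U q) ^ 2 := sum_nonneg fun q _ => sq_nonneg _
    calc c * βKj * ∑ a : Plaq (F.P K) j, GaugeGroup.dist1 (GaugeField.plaqHol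
            (Averaging.iter (fun i => blockAvg (P := F.P K) (j := i) ℰp) j U) a) ^ 2
        ≤ c * βKj * (D ^ 2 * M * ∑ q : Plaq (F.P K) 0, GaugeGroup.dist1 (GaugeField.plaqHol U q) ^ 2) :=
          mul_le_mul_of_nonneg_left ht (mul_nonneg hc hβKj0)
      _ = c * (D ^ 2 * M) * βKj * ∑ q : Plaq (F.P K) 0, GaugeGroup.dist1 (GaugeField.plaqHol U q) ^ 2 := by ring
      _ ≤ cu * (F.L : ℝ) ^ j * βKj * ∑ q : Plaq (F.P K) 0, GaugeGroup.dist1 (GaugeField.plaqHol U q) ^ 2 :=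
          mul_le_mul_of_nonneg_right (mul_le_mul_of_nonneg_right hcoef hβKj0) hS0
      _ = cu * βK * ∑ q : Plaq (F.P K) 0, GaugeGroup.dist1 (GaugeField.plaqHol U q) ^ 2 := by rw [hscale]; ring
  -- integrate and count
  have hint : Integrable (fun U : GaugeField (F.P K) 0 (Matrix.specialUnitaryGroup (Fin 2) ℂ) =>
      Real.exp (cu * βK * ∑ q : Plaq (F.P K) 0, GaugeGroup.dist1 (GaugeField.plaqHol U q) ^ 2)) (gibbsK F ℰp γ K) := by
    refine integrable_of_bounded (((measurable_sqSum F K).const_mul _).exp)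
      (M := Real.exp (cu * βK * (4 * (Fintype.card (Plaq (F.P K) 0) : ℝ)))) fun U => ?_
    rw [abs_of_pos (Real.exp_pos _)]
    exact Real.exp_le_exp.mpr (mul_le_mul_of_nonneg_left (sqSum_mem F U).2 (by positivity))
  refine (integral_mono_of_nonneg (ae_of_all _ fun U => (Real.exp_pos _).le) hint
    (ae_of_all _ fun U => Real.exp_le_exp.mpr (hpt U))).trans (hfine.trans (Real.exp_le_exp.mpr ?_))
  have hPj : (0 : ℝ) ≤ (Fintype.card (Plaq (F.P K) j) : ℝ) := Nat.cast_nonneg _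
  rw [card_plaq_zero_eq_pow_mul F K j hjK]
  calc Cu * ((F.L : ℝ) ^ (3 * j) * (Fintype.card (Plaq (F.P K) j) : ℝ))
      ≤ max Cu 0 * ((F.L : ℝ) ^ (3 * j) * (Fintype.card (Plaq (F.P K) j) : ℝ)) :=
        mul_le_mul_of_nonneg_right (le_max_left _ _) (by positivity)
    _ ≤ max Cu 0 * ((F.L : ℝ) ^ (3 * j₀) * (Fintype.card (Plaq (F.P K) j) : ℝ)) :=
        mul_le_mul_of_nonneg_left (mul_le_mul_of_nonneg_right (pow_le_pow_right₀ hL1 (by omega)) hPj) (le_max_right _ _)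
    _ = max Cu 0 * (F.L : ℝ) ^ (3 * j₀) * (Fintype.card (Plaq (F.P K) j) : ℝ) := by ring

end OfUBS

/-! ## §2 v5's BULK stub from its DEEP tail and UBS -/

section Bulk

/-- **★★ v5's BULK STUB ⇐ ITS DEEP TAIL ∧ UNCAPPED BARE STIFFNESS**: heights `j ≤ j₀` from §1 (sub-threshold ≤ uncapped, pointwise), deep heights
from the tail; constants merged by `min`/`max`. [cite: Balaban1985UV3, (5) p.256 and (70) p.273] -/
theorem subThresholdStiffness_of_deep_and_ubs
    (hD : ∀ (L : ℕ) (b₀ p₀ : ℝ), 0 < b₀ → 2 < p₀ → ∃ (j₀ : ℕ) (c₀ C₀ γ₁ : ℝ), 0 < c₀ ∧ 0 < γ₁ ∧ γ₁ ≤ 1 ∧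
      ∀ (F : T3Family) (γ : ℝ), F.L = L → 0 < γ → γ ≤ γ₁ → ∀ (K j : ℕ), j₀ < j → j ≤ K →
        ∫ U, Real.exp (c₀ * (γ * ((F.L : ℝ)⁻¹) ^ (K - j))⁻¹ *
            ∑ a : Plaq (F.P K) j, (if GaugeGroup.dist1 (GaugeField.plaqHol
              (Averaging.iter (fun i => BlockAveraging.blockAvg (P := F.P K) (j := i) T3UnitLawDensityEML.ℰp) j U) a) <
                T3UnitScaleTilt.θBal F.L γ b₀ p₀ (K - j) then
              GaugeGroup.dist1 (GaugeField.plaqHol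
                (Averaging.iter (fun i => BlockAveraging.blockAvg (P := F.P K) (j := i) T3UnitLawDensityEML.ℰp) j U) a) ^ 2 else 0))
            ∂(T3UnitScaleTilt.gibbsK F T3UnitLawDensityEML.ℰp γ K) ≤
          Real.exp (C₀ * (Fintype.card (Plaq (F.P K) j) : ℝ)))
    (hU : ∀ (L : ℕ), ∃ (c₀ C₀ γ₁ : ℝ), 0 < c₀ ∧ 0 < γ₁ ∧ γ₁ ≤ 1 ∧ ∀ (F : T3Family) (γ : ℝ), F.L = L → 0 < γ → γ ≤ γ₁ → ∀ (K : ℕ),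
      ∫ U, Real.exp (c₀ * (γ * ((F.L : ℝ)⁻¹) ^ K)⁻¹ * ∑ a : Plaq (F.P K) 0, dist1 (GaugeField.plaqHol U a) ^ 2)
          ∂(gibbsK F ℰp γ K) ≤ Real.exp (C₀ * (Fintype.card (Plaq (F.P K) 0) : ℝ))) :
    ∀ (L : ℕ) (b₀ p₀ : ℝ), 0 < b₀ → 2 < p₀ → ∃ (c₀ C₀ γ₁ : ℝ), 0 < c₀ ∧ 0 < γ₁ ∧ γ₁ ≤ 1 ∧
      ∀ (F : T3Family) (γ : ℝ), F.L = L → 0 < γ → γ ≤ γ₁ → ∀ (K j : ℕ), j ≤ K →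
        ∫ U, Real.exp (c₀ * (γ * ((F.L : ℝ)⁻¹) ^ (K - j))⁻¹ *
            ∑ a : Plaq (F.P K) j, (if GaugeGroup.dist1 (GaugeField.plaqHol
              (Averaging.iter (fun i => BlockAveraging.blockAvg (P := F.P K) (j := i) T3UnitLawDensityEML.ℰp) j U) a) <
                T3UnitScaleTilt.θBal F.L γ b₀ p₀ (K - j) then
              GaugeGroup.dist1 (GaugeField.plaqHol
                (Averaging.iter (fun i => BlockAveraging.blockAvg (P := F.P K) (j := i) T3UnitLawDensityEML.ℰp) j U) a) ^ 2 else 0))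
            ∂(T3UnitScaleTilt.gibbsK F T3UnitLawDensityEML.ℰp γ K) ≤
          Real.exp (C₀ * (Fintype.card (Plaq (F.P K) j) : ℝ)) := by
  intro L b₀ p₀ hb₀ hp₀
  obtain ⟨j₀, c₂, C₂, γ₂, hc₂, hγ₂, hγ₂1, hdeep⟩ := hD L b₀ p₀ hb₀ hp₀
  obtain ⟨c₁, C₁, γ₁, hc₁, hγ₁, hγ₁1, hbdd⟩ := coarseStiffness_boundedDepth_of_ubs hU L j₀
  refine ⟨min c₁ c₂, max C₁ C₂, min γ₁ γ₂, lt_min hc₁ hc₂, lt_min hγ₁ hγ₂, (min_le_left _ _).trans hγ₁1,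
    fun F γ hFL hγ hγle K j hjK => ?_⟩
  have hmin0 : 0 ≤ min c₁ c₂ := (lt_min hc₁ hc₂).le
  have hβ0 : 0 ≤ (γ * ((F.L : ℝ)⁻¹) ^ (K - j))⁻¹ := inv_nonneg.2 (mul_nonneg hγ.le (pow_nonneg (inv_nonneg.2 (Nat.cast_nonneg _)) _))
  have hPj : (0 : ℝ) ≤ (Fintype.card (Plaq (F.P K) j) : ℝ) := Nat.cast_nonneg _
  by_cases hj : j ≤ j₀
  · have hB := hbdd F hFL γ hγ (hγle.trans (min_le_left _ _)) K j hj hjK (min c₁ c₂) hmin0 (min_le_left _ _)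
    have hd := integral_exp_avg_dominated_le F hγ K j (mul_nonneg hmin0 hβ0)
      (fun a U => if GaugeGroup.dist1 (GaugeField.plaqHol
          (Averaging.iter (fun i => BlockAveraging.blockAvg (P := F.P K) (j := i) T3UnitLawDensityEML.ℰp) j U) a) <
          T3UnitScaleTilt.θBal F.L γ b₀ p₀ (K - j) then GaugeGroup.dist1 (GaugeField.plaqHol
          (Averaging.iter (fun i => BlockAveraging.blockAvg (P := F.P K) (j := i) T3UnitLawDensityEML.ℰp) j U) a) ^ 2 else 0)
      (fun a U => by
        show (if _ then _ else _) ≤ _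
        split_ifs
        · exact le_rfl
        · exact sq_nonneg _)
      (by simpa only [mul_assoc] using hB)
    have hd' := hd.trans (Real.exp_le_exp.mpr (mul_le_mul_of_nonneg_right (le_max_left C₁ C₂) hPj))
    simpa only [mul_assoc] using hd'
  · have hmono := integral_exp_bulk_mono F hγ K j (T3UnitScaleTilt.θBal F.L γ b₀ p₀ (K - j)) (mul_nonneg hmin0 hβ0)
      (mul_le_mul_of_nonneg_right (min_le_right c₁ c₂) hβ0)
    have hdp := hdeep F γ hFL hγ (hγle.trans (min_le_right _ _)) K j (not_le.1 hj) hjK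
    have hfin := (le_trans (by simpa only [mul_assoc] using hmono) hdp).trans
      (Real.exp_le_exp.mpr (mul_le_mul_of_nonneg_right (le_max_right C₁ C₂) hPj))
    simpa only [mul_assoc] using hfin

end Bulk

/-! ## §3 The exact three-tail factorisation of the crux (skeleton v7's composition and its converse) -/

section Three

/-- **★★★ THE CRUX FROM THE THREE TAILS**: EDGE-deep ∧ BULK-deep ∧ UMA ⇒ `CappedCoarseStiffnessL` (stmt-QuantumFields-25301), through
`uniformLargeFieldCountPos_of_deep` (g13's bounded depths), §2 with `ubs_of_uma` (g12), g9's `uniformLargeFieldCount_of_pos` and g8's factorisation.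
[cite: Balaban1985UV3, (5) p.256 and (71) p.273] -/
theorem cappedCoarseStiffnessL_of_threeStubs
    (hE : ∀ (L : ℕ) (b₀ p₀ : ℝ), 0 < b₀ → 2 < p₀ → ∃ (j₀ : ℕ) (c₀ C₀ γ₁ : ℝ), 0 < c₀ ∧ 0 < γ₁ ∧ γ₁ ≤ 1 ∧
      ∀ (F : T3Family) (γ : ℝ), F.L = L → 0 < γ → γ ≤ γ₁ → ∀ (K j : ℕ), j₀ < j → j ≤ K →
        ∫ U, Real.exp (c₀ * B10.pFun b₀ p₀ (Real.sqrt (γ * ((F.L : ℝ)⁻¹) ^ (K - j))) ^ 2 *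
            ∑ a : Plaq (F.P K) j, (if T3UnitScaleTilt.θBal F.L γ b₀ p₀ (K - j) ≤ GaugeGroup.dist1 (GaugeField.plaqHol
              (Averaging.iter (fun i => BlockAveraging.blockAvg (P := F.P K) (j := i) T3UnitLawDensityEML.ℰp) j U) a)
              then (1 : ℝ) else 0)) ∂(T3UnitScaleTilt.gibbsK F T3UnitLawDensityEML.ℰp γ K) ≤
          Real.exp (C₀ * (Fintype.card (Plaq (F.P K) j) : ℝ)))
    (hD : ∀ (L : ℕ) (b₀ p₀ : ℝ), 0 < b₀ → 2 < p₀ → ∃ (j₀ : ℕ) (c₀ C₀ γ₁ : ℝ), 0 < c₀ ∧ 0 < γ₁ ∧ γ₁ ≤ 1 ∧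
      ∀ (F : T3Family) (γ : ℝ), F.L = L → 0 < γ → γ ≤ γ₁ → ∀ (K j : ℕ), j₀ < j → j ≤ K →
        ∫ U, Real.exp (c₀ * (γ * ((F.L : ℝ)⁻¹) ^ (K - j))⁻¹ *
            ∑ a : Plaq (F.P K) j, (if GaugeGroup.dist1 (GaugeField.plaqHol
              (Averaging.iter (fun i => BlockAveraging.blockAvg (P := F.P K) (j := i) T3UnitLawDensityEML.ℰp) j U) a) <
                T3UnitScaleTilt.θBal F.L γ b₀ p₀ (K - j) then
              GaugeGroup.dist1 (GaugeField.plaqHol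
                (Averaging.iter (fun i => BlockAveraging.blockAvg (P := F.P K) (j := i) T3UnitLawDensityEML.ℰp) j U) a) ^ 2 else 0))
            ∂(T3UnitScaleTilt.gibbsK F T3UnitLawDensityEML.ℰp γ K) ≤
          Real.exp (C₀ * (Fintype.card (Plaq (F.P K) j) : ℝ)))
    (hM : ∀ (L : ℕ), ∃ (C γ₁ : ℝ), 0 < γ₁ ∧ γ₁ ≤ 1 ∧ ∀ (F : T3Family) (γ : ℝ), F.L = L → 0 < γ → γ ≤ γ₁ → ∀ (K : ℕ),
      (γ * ((F.L : ℝ)⁻¹) ^ K)⁻¹ * ∫ U, (∑ a : Plaq (F.P K) 0, dist1 (GaugeField.plaqHol U a) ^ 2) ∂(gibbsK F ℰp γ K) ≤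
        C * (Fintype.card (Plaq (F.P K) 0) : ℝ)) :
    Summit.QuantumFields.YangMills.Theses.CoarseStiffnessTail.CappedCoarseStiffnessL :=
  cappedCoarseStiffnessL_of_subThreshold_and_uniformCount (subThresholdStiffness_of_deep_and_ubs hD (ubs_of_uma hM))
    (uniformLargeFieldCount_of_pos (uniformLargeFieldCountPos_of_deep hE))

/-- **★★★ THE CONVERSE: THE CRUX IMPLIES THE THREE TAILS** (g8's `uniformLargeFieldCount_of_cappedCoarseStiffnessL` /
`subThresholdStiffness_of_cappedCoarseStiffnessL` restricted to `j > 0`, g12's `uma_of_cappedCoarseStiffnessL`) — the factorisation is exact.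
[cite: Balaban1985UV3, (5) p.256 and (71) p.273] -/
theorem threeStubs_of_cappedCoarseStiffnessL (h : Summit.QuantumFields.YangMills.Theses.CoarseStiffnessTail.CappedCoarseStiffnessL) :
    (∀ (L : ℕ) (b₀ p₀ : ℝ), 0 < b₀ → 2 < p₀ → ∃ (j₀ : ℕ) (c₀ C₀ γ₁ : ℝ), 0 < c₀ ∧ 0 < γ₁ ∧ γ₁ ≤ 1 ∧
      ∀ (F : T3Family) (γ : ℝ), F.L = L → 0 < γ → γ ≤ γ₁ → ∀ (K j : ℕ), j₀ < j → j ≤ K →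
        ∫ U, Real.exp (c₀ * B10.pFun b₀ p₀ (Real.sqrt (γ * ((F.L : ℝ)⁻¹) ^ (K - j))) ^ 2 *
            ∑ a : Plaq (F.P K) j, (if T3UnitScaleTilt.θBal F.L γ b₀ p₀ (K - j) ≤ GaugeGroup.dist1 (GaugeField.plaqHol
              (Averaging.iter (fun i => BlockAveraging.blockAvg (P := F.P K) (j := i) T3UnitLawDensityEML.ℰp) j U) a)
              then (1 : ℝ) else 0)) ∂(T3UnitScaleTilt.gibbsK F T3UnitLawDensityEML.ℰp γ K) ≤
          Real.exp (C₀ * (Fintype.card (Plaq (F.P K) j) : ℝ))) ∧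
    (∀ (L : ℕ) (b₀ p₀ : ℝ), 0 < b₀ → 2 < p₀ → ∃ (j₀ : ℕ) (c₀ C₀ γ₁ : ℝ), 0 < c₀ ∧ 0 < γ₁ ∧ γ₁ ≤ 1 ∧
      ∀ (F : T3Family) (γ : ℝ), F.L = L → 0 < γ → γ ≤ γ₁ → ∀ (K j : ℕ), j₀ < j → j ≤ K →
        ∫ U, Real.exp (c₀ * (γ * ((F.L : ℝ)⁻¹) ^ (K - j))⁻¹ *
            ∑ a : Plaq (F.P K) j, (if GaugeGroup.dist1 (GaugeField.plaqHol
              (Averaging.iter (fun i => BlockAveraging.blockAvg (P := F.P K) (j := i) T3UnitLawDensityEML.ℰp) j U) a) <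
                T3UnitScaleTilt.θBal F.L γ b₀ p₀ (K - j) then
              GaugeGroup.dist1 (GaugeField.plaqHol
                (Averaging.iter (fun i => BlockAveraging.blockAvg (P := F.P K) (j := i) T3UnitLawDensityEML.ℰp) j U) a) ^ 2 else 0))
            ∂(T3UnitScaleTilt.gibbsK F T3UnitLawDensityEML.ℰp γ K) ≤
          Real.exp (C₀ * (Fintype.card (Plaq (F.P K) j) : ℝ))) ∧
    (∀ (L : ℕ), ∃ (C γ₁ : ℝ), 0 < γ₁ ∧ γ₁ ≤ 1 ∧ ∀ (F : T3Family) (γ : ℝ), F.L = L → 0 < γ → γ ≤ γ₁ → ∀ (K : ℕ),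
      (γ * ((F.L : ℝ)⁻¹) ^ K)⁻¹ * ∫ U, (∑ a : Plaq (F.P K) 0, dist1 (GaugeField.plaqHol U a) ^ 2) ∂(gibbsK F ℰp γ K) ≤
        C * (Fintype.card (Plaq (F.P K) 0) : ℝ)) := by
  refine ⟨fun L b₀ p₀ hb hp => ?_, fun L b₀ p₀ hb hp => ?_, uma_of_cappedCoarseStiffnessL h⟩
  · obtain ⟨c₀, C₀, γ₁, hc, hγ, hγ1, h'⟩ := uniformLargeFieldCount_of_cappedCoarseStiffnessL h L b₀ p₀ hb hp
    exact ⟨0, c₀, C₀, γ₁, hc, hγ, hγ1, fun F γ hL hγ' hγ1' K j _ hjK => h' F γ hL hγ' hγ1' K j hjK⟩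
  · obtain ⟨c₀, C₀, γ₁, hc, hγ, hγ1, h'⟩ := subThresholdStiffness_of_cappedCoarseStiffnessL h L b₀ p₀ hb hp
    exact ⟨0, c₀, C₀, γ₁, hc, hγ, hγ1, fun F γ hL hγ' hγ1' K j _ hjK => h' F γ hL hγ' hγ1' K j hjK⟩

end Three

end Summit.QuantumFields.YangMills.Theorems.CoarseStiffnessTailThreeTails

end
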